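import Literature.Analysis.Complex.RectangleSlitContour
import Literature.Analysis.Complex.RectangleContourTools
import Mathlib.Analysis.SpecialFunctions.Gamma.Beta
import Mathlib.Analysis.SpecialFunctions.Complex.Log
import HarnessLib

/-!
# Hankel's loop integral for `1/Γ(z)`, truncated (Montgomery–Vaughan Theorem C.3; MV §7.4 p. 178)

Topic `Literature/Analysis/Complex`. Everything here is PROVED (theorems only, no definitions).

Hankel's formula `1/Γ(z) = (1/2πi) ∫_ℋ w^{−z} e^{w} dw`, `ℋ` a loop from `−∞` around the branch cut
`(−∞, 0]` of `w^{−z} = exp(−z Log w)` back to `−∞` (Montgomery–Vaughan, *Multiplicative Number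
Theory I*, Appendix C, Theorem C.3), is used in the Selberg–Delange method in TRUNCATED and
RECTANGULAR form (MV §7.4, proof of Theorem 7.17, p. 178: "`ℋ₂` starts at `−β − i`, loops around
`0`, and ends at `−β + i` … the integral over `ℋ₁` is `≪_R ∫_β^∞ e^{−u/2} du ≪_R e^{−β/2}`").
We prove exactly the statement consumed there: for the three-sided rectangular loop
`−β − i → 1 − i → 1 + i → −β + i` and the integrand `e^{w} w^{−z} = exp(w − z Log w)`,

  `‖ ∫_{−β}^{1} F(x − i) dx − ∫_{−β}^{1} F(x + i) dx + i ∫_{−1}^{1} F(1 + iy) dy − 2πi/Γ(z) ‖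
      ≤ C_R e^{−β/2}`   for `‖z‖ ≤ R`, `β ≥ 1`

(`hankel_loop_sub_inv_Gamma_le`). Proof: for `Re z < 1` the closed rectangle `[−β, 1] × [−1, 1]`
slit along `(−∞, 0]` collapses onto the cut (`rectBoundaryIntegral_eq_slitIntegral` of
`RectangleSlitContour.lean`), the jump of `w^{−z}` across the cut being `2i sin(πz) |x|^{−z}`, and
`∫_0^∞ e^{−v} v^{−z} dv = Γ(1 − z)` with the reflection formula gives `2πi/Γ(z)` up to the two
exponentially small pieces (the left edge at `Re w = −β` and the tail `∫_β^∞`); all terms being entire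
in `z`, the identity extends from `Re z < 1` to all `z` by analytic continuation.

## References

* [MontgomeryVaughan2007] H. L. Montgomery, R. C. Vaughan, *Multiplicative Number Theory I*,
  CUP 2007, Appendix C Theorem C.3 (Hankel's formula) and §7.4, proof of Theorem 7.17, p. 178.
-/

noncomputable section

open Complex Set MeasureTheory Filter Topology intervalIntegral Metric
open scoped Real Interval

namespace Literature.Analysis.Complex

namespace Hankel

/-! ### The integrand `e^{w} w^{−z} = exp(w − z Log w)` -/

/-- Holomorphy of the integrand in `w` on the slit plane. [folklore] -/
theorem differentiableAt_integrand (z : ℂ) {w : ℂ} (hw : w ∈ slitPlane) :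
    DifferentiableAt ℂ (fun w ↦ exp (w - z * log w)) w :=
  (differentiableAt_id.sub ((differentiableAt_const z).mul (differentiableAt_id.clog hw))).cexp

/-- Off the cut `{Im w = 0, Re w ≤ 0}` every point lies in the slit plane. [folklore] -/
theorem mem_slitPlane_of_not_mem_cut {w : ℂ} (hw : w ∈ (univ : Set ℂ) \ {w : ℂ | w.im = 0 ∧ w.re ≤ 0}) :
    w ∈ slitPlane := by
  rw [mem_slitPlane_iff]
  simp only [Set.mem_sdiff, mem_univ, mem_setOf_eq, true_and, not_and, not_le] at hw
  by_cases h : w.im = 0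
  · exact Or.inl (hw h)
  · exact Or.inr h

/-- Holomorphy of the integrand in `w` off the cut. [folklore] -/
theorem differentiableOn_integrand (z : ℂ) :
    DifferentiableOn ℂ (fun w ↦ exp (w - z * log w))
      ((univ : Set ℂ) \ {w : ℂ | w.im = 0 ∧ w.re ≤ 0}) := fun _ hw ↦
  (differentiableAt_integrand z (mem_slitPlane_of_not_mem_cut hw)).differentiableWithinAt

/-- The integrand is entire in the parameter `z`. [folklore] -/
theorem differentiable_integrand_param (w : ℂ) :
    Differentiable ℂ (fun z : ℂ ↦ exp (w - z * log w)) := by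
  fun_prop

/-- The modulus of the integrand: `‖exp(w − z Log w)‖ = exp(Re w − Re z · log‖w‖ + Im z · arg w)`.
[folklore] -/
theorem norm_integrand (z w : ℂ) :
    ‖exp (w - z * log w)‖ = Real.exp (w.re - z.re * Real.log ‖w‖ + z.im * arg w) := by
  rw [norm_exp]
  congr 1
  simp only [sub_re, mul_re, log_re, log_im]
  ring

/-- **Pointwise bound for the integrand**: for `w ≠ 0`,
`‖exp(w − z Log w)‖ ≤ e^{Re w} ‖w‖^{−Re z} e^{π |Im z|}`. [folklore] -/
theorem norm_integrand_le {z w : ℂ} (hw : w ≠ 0) :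
    ‖exp (w - z * log w)‖ ≤ Real.exp w.re * ‖w‖ ^ (-z.re) * Real.exp (π * |z.im|) := by
  rw [norm_integrand, Real.rpow_def_of_pos (norm_pos_iff.2 hw), ← Real.exp_add, ← Real.exp_add,
    Real.exp_le_exp]
  have h1 : z.im * arg w ≤ π * |z.im| := by
    have ha : |arg w| ≤ π := abs_arg_le_pi w
    calc z.im * arg w ≤ |z.im * arg w| := le_abs_self _
      _ = |z.im| * |arg w| := abs_mul _ _
      _ ≤ |z.im| * π := by gcongr
      _ = π * |z.im| := by ring
  nlinarith

/-! ### Boundary values on the cut -/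

/-- **Lower boundary value**: as `w → x < 0` from `Im w < 0`,
`exp(w − z Log w) → exp(x − z (log|x| − iπ))`. [folklore] -/
theorem tendsto_integrand_lower (z : ℂ) {x : ℝ} (hx : x < 0) :
    Tendsto (fun w ↦ exp (w - z * log w)) (𝓝[{w : ℂ | w.im < 0}] (x : ℂ))
      (𝓝 (exp (x - z * (Real.log |x| - π * I)))) := by
  have hlog := tendsto_log_nhdsWithin_im_neg_of_re_neg_of_im_zero (z := (x : ℂ))
    (by simpa using hx) (by simp)
  rw [Complex.norm_real, Real.norm_eq_abs] at hlog
  have hid : Tendsto (fun w : ℂ ↦ w) (𝓝[{w : ℂ | w.im < 0}] (x : ℂ)) (𝓝 (x : ℂ)) :=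
    tendsto_nhdsWithin_of_tendsto_nhds tendsto_id
  exact (hid.sub (tendsto_const_nhds.mul hlog)).cexp

/-- **Upper boundary value**: as `w → x < 0` from `Im w > 0`,
`exp(w − z Log w) → exp(x − z (log|x| + iπ))`. [folklore] -/
theorem tendsto_integrand_upper (z : ℂ) {x : ℝ} (hx : x < 0) :
    Tendsto (fun w ↦ exp (w - z * log w)) (𝓝[{w : ℂ | 0 < w.im}] (x : ℂ))
      (𝓝 (exp (x - z * (Real.log |x| + π * I)))) := by
  have hlog := tendsto_log_nhdsWithin_im_nonneg_of_re_neg_of_im_zero (z := (x : ℂ))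
    (by simpa using hx) (by simp)
  rw [Complex.norm_real, Real.norm_eq_abs] at hlog
  have hlog' : Tendsto log (𝓝[{w : ℂ | 0 < w.im}] (x : ℂ)) (𝓝 (Real.log |x| + π * I)) :=
    hlog.mono_left (nhdsWithin_mono _ fun w hw ↦ by
      simp only [mem_setOf_eq] at hw ⊢; exact hw.le)
  have hid : Tendsto (fun w : ℂ ↦ w) (𝓝[{w : ℂ | 0 < w.im}] (x : ℂ)) (𝓝 (x : ℂ)) :=
    tendsto_nhdsWithin_of_tendsto_nhds tendsto_id
  exact (hid.sub (tendsto_const_nhds.mul hlog')).cexp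

/-- The jump across the cut: `F₋(x) − F₊(x) = e^{x} |x|^{−z} · 2i sin(πz)` (`x < 0`), where
`|x|^{−z} = exp(−z log|x|)`. [folklore] -/
theorem lower_sub_upper (z : ℂ) (x : ℝ) :
    exp (x - z * (Real.log |x| - π * I)) - exp (x - z * (Real.log |x| + π * I)) =
      exp (x - z * Real.log |x|) * (2 * I * Complex.sin (π * z)) := by
  have h1 : (x : ℂ) - z * (Real.log |x| - π * I) = (x - z * Real.log |x|) + (π * z) * I := by ring
  have h2 : (x : ℂ) - z * (Real.log |x| + π * I) = (x - z * Real.log |x|) + -((π * z) * I) := by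
    ring
  have hs : 2 * I * Complex.sin (π * z) = exp (π * z * I) - exp (-(π * z * I)) := by
    rw [Complex.sin, neg_mul]
    linear_combination (exp (-(π * z * I)) - exp (π * z * I)) * I_mul_I
  rw [h1, h2, Complex.exp_add, Complex.exp_add, hs]
  ring


/-- Lower boundary value, product form: `F₋(x) = exp(x − z log|x|) · e^{iπz}`. [folklore] -/
theorem tendsto_integrand_lower' (z : ℂ) {x : ℝ} (hx : x < 0) :
    Tendsto (fun w ↦ exp (w - z * log w)) (𝓝[{w : ℂ | w.im < 0}] (x : ℂ))
      (𝓝 (exp (x - z * Real.log |x|) * exp (π * z * I))) := by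
  have h := tendsto_integrand_lower z hx
  rwa [show (x : ℂ) - z * (Real.log |x| - π * I) = (x - z * Real.log |x|) + π * z * I by ring,
    Complex.exp_add] at h

/-- Upper boundary value, product form: `F₊(x) = exp(x − z log|x|) · e^{−iπz}`. [folklore] -/
theorem tendsto_integrand_upper' (z : ℂ) {x : ℝ} (hx : x < 0) :
    Tendsto (fun w ↦ exp (w - z * log w)) (𝓝[{w : ℂ | 0 < w.im}] (x : ℂ))
      (𝓝 (exp (x - z * Real.log |x|) * exp (-(π * z * I)))) := by
  have h := tendsto_integrand_upper z hx
  rwa [show (x : ℂ) - z * (Real.log |x| + π * I) = (x - z * Real.log |x|) + -(π * z * I) by ring,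
    Complex.exp_add] at h

/-- `2i sin(πz) = e^{iπz} − e^{−iπz}`. [folklore] -/
theorem two_I_mul_sin (z : ℂ) :
    2 * I * Complex.sin (π * z) = exp (π * z * I) - exp (-(π * z * I)) := by
  rw [Complex.sin, neg_mul]
  linear_combination (exp (-(π * z * I)) - exp (π * z * I)) * I_mul_I

/-! ### Elementary `rpow` bookkeeping for `‖w‖^{−Re z}` -/

/-- For `0 < n ≤ B`, `1 ≤ B`: `n^{−Re z} ≤ B^{|Re z|} · n^{−max(Re z, 0)}`. [folklore] -/
theorem rpow_neg_re_le {n B t : ℝ} (hn0 : 0 < n) (hn : n ≤ B) (hB : 1 ≤ B) :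
    n ^ (-t) ≤ B ^ |t| * n ^ (-(max t 0)) := by
  have hB1 : 1 ≤ B ^ |t| := Real.one_le_rpow hB (abs_nonneg t)
  rcases le_or_gt 0 t with ht | ht
  · rw [max_eq_left ht]
    have h0 : 0 ≤ n ^ (-t) := Real.rpow_nonneg hn0.le _
    nlinarith
  · rw [max_eq_right ht.le, neg_zero, Real.rpow_zero, mul_one, abs_of_neg ht]
    exact Real.rpow_le_rpow hn0.le hn (by linarith)

/-- For `1 ≤ n ≤ B`: `n^{−Re z} ≤ B^{|Re z|}`. [folklore] -/
theorem rpow_neg_re_le' {n B t : ℝ} (hn1 : 1 ≤ n) (hn : n ≤ B) :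
    n ^ (-t) ≤ B ^ |t| := by
  have hB : 1 ≤ B := hn1.trans hn
  have h := rpow_neg_re_le (lt_of_lt_of_le one_pos hn1) hn hB (t := t)
  have h2 : n ^ (-(max t 0)) ≤ 1 :=
    Real.rpow_le_one_of_one_le_of_nonpos hn1 (by simp)
  have h3 : 0 ≤ B ^ |t| := Real.rpow_nonneg (by linarith) _
  calc n ^ (-t) ≤ B ^ |t| * n ^ (-(max t 0)) := h
    _ ≤ B ^ |t| * 1 := by gcongr
    _ = B ^ |t| := mul_one _

/-- `‖x + yi‖ ≤ |x| + |y|`. [folklore] -/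
theorem norm_add_mul_I_le (x y : ℝ) : ‖(x : ℂ) + (y : ℂ) * I‖ ≤ |x| + |y| := by
  calc ‖(x : ℂ) + (y : ℂ) * I‖ ≤ ‖(x : ℂ)‖ + ‖(y : ℂ) * I‖ := norm_add_le _ _
    _ = |x| + |y| := by simp

/-! ### The closed rectangle collapses onto the cut (`Re z < 1`) -/

/-- **Collapse onto the cut.** For `Re z < 1` and `β ≥ 1`, the boundary integral of
`exp(w − z Log w)` over the rectangle `[−β, 1] × [−1, 1]` equals the integral of the jump across
the cut: `2i sin(πz) ∫_{−β}^{0} exp(x − z log|x|) dx`. [cite: MontgomeryVaughan2007, Theorem C.3] -/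
theorem rect_eq_cut_integral {z : ℂ} (hz : z.re < 1) {β : ℝ} (hβ : 1 ≤ β) :
    rectBoundaryIntegral (fun w ↦ exp (w - z * log w)) (-β) 1 (-1) 1 =
      (2 * I * Complex.sin (π * z)) * ∫ x in -β..0, exp ((x : ℂ) - z * Real.log |x|) := by
  set F : ℂ → ℂ := fun w ↦ exp (w - z * log w) with hFdef
  set μ : ℝ := max z.re 0 with hμ
  have hμ1 : μ < 1 := max_lt hz one_pos
  set C : ℝ := Real.exp (1 / 2) * Real.exp (π * |z.im|) * (β + 1) ^ |z.re| with hC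
  have hC0 : 0 ≤ C := by positivity
  have hβ1 : (1 : ℝ) ≤ β + 1 := by linarith
  -- the bound near the branch point
  have hbound : ∀ w ∈ ({w : ℂ | -β ≤ w.re ∧ w.re ≤ 0 + 1 / 2 ∧ |w.im - 0| ≤ 1 / 2} \
      {w : ℂ | w.im = 0 ∧ w.re ≤ 0}),
      ‖F w‖ ≤ C * ‖w - (((0 : ℝ) : ℂ) + ((0 : ℝ) : ℂ) * I)‖ ^ (-μ) := by
    rintro w ⟨⟨h1, h2, h3⟩, h4⟩
    simp only [sub_zero] at h3
    simp only [mem_setOf_eq, not_and, not_le] at h4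
    have hw0 : w ≠ 0 := by
      rintro rfl
      exact absurd (h4 rfl) (by simp)
    have hwn : 0 < ‖w‖ := norm_pos_iff.2 hw0
    have hwB : ‖w‖ ≤ β + 1 := by
      calc ‖w‖ ≤ |w.re| + |w.im| := Complex.norm_le_abs_re_add_abs_im w
        _ ≤ β + 1 := by
            have : |w.re| ≤ β := abs_le.2 ⟨by linarith, by linarith⟩
            linarith
    simp only [ofReal_zero, zero_mul, add_zero, sub_zero]
    calc ‖F w‖ ≤ Real.exp w.re * ‖w‖ ^ (-z.re) * Real.exp (π * |z.im|) := norm_integrand_le hw0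
      _ ≤ Real.exp (1 / 2) * ((β + 1) ^ |z.re| * ‖w‖ ^ (-μ)) * Real.exp (π * |z.im|) := by
          gcongr
          · linarith
          · exact rpow_neg_re_le hwn hwB hβ1
      _ = C * ‖w‖ ^ (-μ) := by rw [hC]; ring
  -- the left edge crosses the cut at one point but stays integrable
  have hleft : IntervalIntegrable (fun y : ℝ ↦ F (((-β : ℝ) : ℂ) + (y : ℂ) * I)) volume (-1) 1 := by
    refine intervalIntegrable_of_bounded_of_continuousOn_diff_finite (by norm_num)
      (Set.finite_singleton (0 : ℝ)) ?_ (B := Real.exp (-β) * (β + 1) ^ |z.re| * Real.exp (π * |z.im|)) ?_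
    · intro y hy
      have hy0 : y ≠ 0 := fun h ↦ hy.2 (by simp [h])
      have hslit : ((-β : ℝ) : ℂ) + (y : ℂ) * I ∈ slitPlane :=
        mem_slitPlane_iff.2 (Or.inr (by simpa using hy0))
      exact (ContinuousAt.comp (g := F) (f := fun y : ℝ ↦ ((-β : ℝ) : ℂ) + (y : ℂ) * I)
        (differentiableAt_integrand z hslit).continuousAt
        (by fun_prop : Continuous fun y : ℝ ↦ ((-β : ℝ) : ℂ) + (y : ℂ) * I).continuousAt).continuousWithinAt
    · intro y hy
      have hy1 : |y| ≤ 1 := abs_le.2 ⟨hy.1.1, hy.1.2⟩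
      set w : ℂ := ((-β : ℝ) : ℂ) + (y : ℂ) * I with hw
      have hwre : w.re = -β := by simp [hw]
      have hw0 : w ≠ 0 := fun h ↦ by
        have := congrArg Complex.re h; rw [hwre] at this; simp at this; linarith
      have hwn1 : 1 ≤ ‖w‖ := by
        calc (1 : ℝ) ≤ β := hβ
          _ = |w.re| := by rw [hwre, abs_neg, abs_of_pos (by linarith)]
          _ ≤ ‖w‖ := abs_re_le_norm w
      have hwB : ‖w‖ ≤ β + 1 := by
        calc ‖w‖ ≤ |(-β : ℝ)| + |y| := norm_add_mul_I_le _ _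
          _ ≤ β + 1 := by rw [abs_neg, abs_of_pos (by linarith)]; linarith
      calc ‖F w‖ ≤ Real.exp w.re * ‖w‖ ^ (-z.re) * Real.exp (π * |z.im|) := norm_integrand_le hw0
        _ ≤ Real.exp (-β) * (β + 1) ^ |z.re| * Real.exp (π * |z.im|) := by
            rw [hwre]
            gcongr
            exact rpow_neg_re_le' hwn1 hwB
  have key := rectBoundaryIntegral_eq_slitIntegral (F := F) (a := -β) (b := 1) (c := -1) (d := 1)
    (ξ := 0) (h := 0) (r := 1 / 2) (C := C) (μ := μ) (U := univ)
    (by linarith) (by norm_num) (by norm_num) (by norm_num) (by norm_num) hμ1 hC0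
    (subset_univ _) (differentiableOn_integrand z) hbound hleft
    (Fm := fun x ↦ exp (x - z * Real.log |x|) * exp (π * z * I))
    (Fp := fun x ↦ exp (x - z * Real.log |x|) * exp (-(π * z * I)))
    (fun x hx ↦ by simpa using tendsto_integrand_lower' z hx.2)
    (fun x hx ↦ by simpa using tendsto_integrand_upper' z hx.2)
  rw [key, intervalIntegral.integral_mul_const, intervalIntegral.integral_mul_const, ← mul_sub,
    ← two_I_mul_sin, mul_comm]


/-! ### The cut integral is a truncated `Γ(1 − z)` -/

/-- For `v > 0`: `exp(−v − z log v) = e^{−v} · v^{−z}` (principal power of the positive real `v`).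
[folklore] -/
theorem exp_neg_sub_mul_log_eq {v : ℝ} (hv : 0 < v) (z : ℂ) :
    exp (-(v : ℂ) - z * Real.log v) = ((Real.exp (-v) : ℝ) : ℂ) * (v : ℂ) ^ (-z) := by
  rw [cpow_def_of_ne_zero (ofReal_ne_zero.2 hv.ne'), ← ofReal_log hv.le, ofReal_exp,
    ← Complex.exp_add]
  congr 1
  push_cast
  ring

/-- The substitution `x = −v`: `∫_{−β}^{0} exp(x − z log|x|) dx = ∫_0^β e^{−v} v^{−z} dv`. [folklore] -/
theorem cut_integral_eq (z : ℂ) (β : ℝ) (hβ : 0 ≤ β) :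
    ∫ x in -β..0, exp ((x : ℂ) - z * Real.log |x|) =
      ∫ v in (0 : ℝ)..β, ((Real.exp (-v) : ℝ) : ℂ) * (v : ℂ) ^ (-z) := by
  have h1 : ∫ v in (0 : ℝ)..β, ((Real.exp (-v) : ℝ) : ℂ) * (v : ℂ) ^ (-z) =
      ∫ v in (0 : ℝ)..β, exp (((-v : ℝ) : ℂ) - z * Real.log |-v|) := by
    refine intervalIntegral.integral_congr_ae ?_
    refine Eventually.of_forall fun v hv ↦ ?_
    rw [uIoc_of_le hβ] at hv
    rw [abs_neg, abs_of_pos hv.1, ← exp_neg_sub_mul_log_eq hv.1]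
    push_cast
    ring_nf
  rw [h1, intervalIntegral.integral_comp_neg (fun x : ℝ ↦ exp ((x : ℂ) - z * Real.log |x|)),
    neg_zero]

/-- `∫_0^∞ e^{−v} v^{−z} dv = Γ(1 − z)` for `Re z < 1`, split at `β`:
`∫_0^β e^{−v} v^{−z} dv = Γ(1 − z) − ∫_β^∞ e^{−v} v^{−z} dv`. [folklore] -/
theorem integral_eq_Gamma_sub_tail {z : ℂ} (hz : z.re < 1) {β : ℝ} (hβ : 0 ≤ β) :
    ∫ v in (0 : ℝ)..β, ((Real.exp (-v) : ℝ) : ℂ) * (v : ℂ) ^ (-z) =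
      Complex.Gamma (1 - z) - ∫ v in Ioi β, ((Real.exp (-v) : ℝ) : ℂ) * (v : ℂ) ^ (-z) := by
  have hs : 0 < (1 - z).re := by simp; linarith
  have hconv := Complex.GammaIntegral_convergent hs
  have e : (fun x : ℝ ↦ ((Real.exp (-x) : ℝ) : ℂ) * (x : ℂ) ^ (1 - z - 1)) =
      fun x : ℝ ↦ ((Real.exp (-x) : ℝ) : ℂ) * (x : ℂ) ^ (-z) := by
    funext x; congr 2; ring
  rw [e] at hconv
  have hsplit := intervalIntegral.integral_interval_add_Ioi (a := 0) (b := β) hconv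
    (hconv.mono_set (Ioi_subset_Ioi hβ))
  rw [Complex.Gamma_eq_integral hs, Complex.GammaIntegral, e, ← hsplit]
  ring

/-- **The reflection formula in the form `2i sin(πz) Γ(1 − z) = 2πi/Γ(z)`** (`Re z < 1`; both
sides vanish at `z = 0, −1, −2, …`). [folklore] -/
theorem two_I_sin_mul_Gamma_one_sub {z : ℂ} (hz : z.re < 1) :
    2 * I * Complex.sin (π * z) * Complex.Gamma (1 - z) = 2 * π * I / Complex.Gamma z := by
  by_cases h : ∃ m : ℕ, z = -m
  · obtain ⟨m, rfl⟩ := h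
    rw [Complex.Gamma_neg_nat_eq_zero, div_zero]
    have : Complex.sin (π * -(m : ℂ)) = 0 := by
      rw [Complex.sin_eq_zero_iff]
      exact ⟨-m, by push_cast; ring⟩
    rw [this]; ring
  · push Not at h
    have hΓ : Complex.Gamma z ≠ 0 := Complex.Gamma_ne_zero h
    have hsin : Complex.sin (π * z) ≠ 0 := by
      intro h0
      rw [Complex.sin_eq_zero_iff] at h0
      obtain ⟨k, hk⟩ := h0
      have hzk : z = k := by
        have hπ : (π : ℂ) ≠ 0 := ofReal_ne_zero.2 Real.pi_pos.ne'
        field_simp at hk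
        linear_combination hk
      have hk1 : (k : ℝ) < 1 := by
        have := hz; rw [hzk] at this; simpa using this
      have hk0 : k ≤ 0 := by
        have : k < 1 := by exact_mod_cast hk1
        omega
      obtain ⟨m, hm⟩ := Int.exists_eq_neg_ofNat hk0
      exact h m (by rw [hzk, hm]; push_cast; ring)
    have hrefl := Complex.Gamma_mul_Gamma_one_sub z
    have hG1 : Complex.Gamma (1 - z) = π / Complex.sin (π * z) / Complex.Gamma z := by
      rw [eq_div_iff hΓ, mul_comm]
      exact hrefl
    rw [hG1, div_div, show 2 * I * Complex.sin (π * z) * (π / (Complex.sin (π * z) * Complex.Gamma z))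
        = 2 * π * I / Complex.Gamma z * (Complex.sin (π * z) / Complex.sin (π * z)) by ring,
      div_self hsin, mul_one]

/-- **Hankel's identity for `Re z < 1`, truncated form.** With `F(w) = exp(w − z Log w)`, `β ≥ 1`:
`∮_{∂([−β,1]×[−1,1])} F + i ∫_{−1}^{1} F(−β + iy) dy − 2πi/Γ(z) = i ∫_{−1}^{1} F(−β + iy) dy
− 2i sin(πz) ∫_β^∞ e^{−v} v^{−z} dv` (the left-hand side is the three-sided loop minus `2πi/Γ(z)`).
[cite: MontgomeryVaughan2007, Theorem C.3] -/
theorem loop_sub_eq_of_re_lt_one {z : ℂ} (hz : z.re < 1) {β : ℝ} (hβ : 1 ≤ β) :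
    rectBoundaryIntegral (fun w ↦ exp (w - z * log w)) (-β) 1 (-1) 1 +
        I * (∫ y in (-1 : ℝ)..1, exp ((((-β : ℝ) : ℂ) + (y : ℂ) * I) -
          z * log (((-β : ℝ) : ℂ) + (y : ℂ) * I))) -
        2 * π * I / Complex.Gamma z =
      I * (∫ y in (-1 : ℝ)..1, exp ((((-β : ℝ) : ℂ) + (y : ℂ) * I) -
          z * log (((-β : ℝ) : ℂ) + (y : ℂ) * I))) -
        2 * I * Complex.sin (π * z) *
          ∫ v in Ioi β, ((Real.exp (-v) : ℝ) : ℂ) * (v : ℂ) ^ (-z) := by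
  have hβ0 : 0 ≤ β := by linarith
  rw [rect_eq_cut_integral hz hβ, cut_integral_eq z β hβ0, integral_eq_Gamma_sub_tail hz hβ0,
    mul_sub, two_I_sin_mul_Gamma_one_sub hz]
  ring


/-- The tail in exponential form: `∫_β^∞ e^{−v} v^{−z} dv = ∫_β^∞ exp(−v − z log v) dv` (`β ≥ 0`).
[folklore] -/
theorem tail_eq_exp_form (z : ℂ) {β : ℝ} (hβ : 0 ≤ β) :
    ∫ v in Ioi β, ((Real.exp (-v) : ℝ) : ℂ) * (v : ℂ) ^ (-z) =
      ∫ v in Ioi β, exp (-(v : ℂ) - z * Real.log v) := by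
  refine setIntegral_congr_fun measurableSet_Ioi fun v hv ↦ ?_
  exact (exp_neg_sub_mul_log_eq (lt_of_le_of_lt hβ hv) z).symm

/-! ### Entirety in `z` of all the pieces -/

/-- Interval integrals of `exp(p(t) − z Log p(t))` along a continuous path `p` in the slit plane are
entire functions of `z`. [folklore] -/
theorem differentiable_intervalIntegral {p : ℝ → ℂ} (hp : Continuous p)
    (hslit : ∀ t, p t ∈ slitPlane) (a b : ℝ) :
    Differentiable ℂ (fun z : ℂ ↦ ∫ t in a..b, exp (p t - z * log (p t))) := by
  wlog hab : a ≤ b generalizing a b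
  · have h := this b a (le_of_not_ge hab)
    have e : (fun z : ℂ ↦ ∫ t in a..b, exp (p t - z * log (p t))) =
        fun z ↦ -∫ t in b..a, exp (p t - z * log (p t)) := by
      funext z; rw [intervalIntegral.integral_symm]
    rw [e]; exact h.neg
  have hlog : Continuous fun t ↦ log (p t) := hp.clog hslit
  have h := differentiableOn_intervalIntegral_of_continuousOn
    (g := fun (z : ℂ) (t : ℝ) ↦ exp (p t - z * log (p t))) (U := univ) isOpen_univ hab
    (fun t _ ↦ (differentiable_integrand_param (p t)).differentiableOn) ?_
  · exact differentiableOn_univ.1 h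
  · have hc : Continuous fun q : ℂ × ℝ ↦ exp (p q.2 - q.1 * log (p q.2)) :=
      ((hp.comp continuous_snd).sub (continuous_fst.mul (hlog.comp continuous_snd))).cexp
    exact hc.continuousOn

/-- The three-sided loop `bottom − top + i·right` is entire in `z`. [folklore] -/
theorem differentiable_loop (β : ℝ) :
    Differentiable ℂ (fun z : ℂ ↦
      (∫ x in -β..1, exp (((x : ℂ) + ((-1 : ℝ) : ℂ) * I) - z * log ((x : ℂ) + ((-1 : ℝ) : ℂ) * I))) -
      (∫ x in -β..1, exp (((x : ℂ) + ((1 : ℝ) : ℂ) * I) - z * log ((x : ℂ) + ((1 : ℝ) : ℂ) * I))) +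
      I * ∫ y in (-1 : ℝ)..1, exp ((((1 : ℝ) : ℂ) + (y : ℂ) * I) -
        z * log (((1 : ℝ) : ℂ) + (y : ℂ) * I))) := by
  have hbot := differentiable_intervalIntegral (p := fun x : ℝ ↦ (x : ℂ) + ((-1 : ℝ) : ℂ) * I)
    (by fun_prop) (fun x ↦ mem_slitPlane_iff.2 (Or.inr (by simp))) (-β) 1
  have htop := differentiable_intervalIntegral (p := fun x : ℝ ↦ (x : ℂ) + ((1 : ℝ) : ℂ) * I)
    (by fun_prop) (fun x ↦ mem_slitPlane_iff.2 (Or.inr (by simp))) (-β) 1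
  have hright := differentiable_intervalIntegral (p := fun y : ℝ ↦ ((1 : ℝ) : ℂ) + (y : ℂ) * I)
    (by fun_prop) (fun y ↦ mem_slitPlane_iff.2 (Or.inl (by simp))) (-1) 1
  exact (hbot.sub htop).add (hright.const_mul I)

/-- The left edge `∫_{−1}^{1} F(−β + iy) dy` is entire in `z` (dominated differentiation; the
integrand is bounded on the edge and merely measurable in `y`). [folklore] -/
theorem differentiable_leftEdge {β : ℝ} (hβ : 1 ≤ β) :
    Differentiable ℂ (fun z : ℂ ↦ ∫ y in (-1 : ℝ)..1,
      exp ((((-β : ℝ) : ℂ) + (y : ℂ) * I) - z * log (((-β : ℝ) : ℂ) + (y : ℂ) * I))) := by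
  set G : ℂ → ℝ → ℂ := fun z y ↦
    exp ((((-β : ℝ) : ℂ) + (y : ℂ) * I) - z * log (((-β : ℝ) : ℂ) + (y : ℂ) * I)) with hG
  have e : (fun z : ℂ ↦ ∫ y in (-1 : ℝ)..1, G z y) =
      fun z ↦ ∫ y, G z y ∂(volume.restrict (Ioc (-1 : ℝ) 1)) := by
    funext z; rw [intervalIntegral.integral_of_le (by norm_num)]
  show Differentiable ℂ (fun z : ℂ ↦ ∫ y in (-1 : ℝ)..1, G z y)
  rw [e]
  refine differentiableOn_univ.1 (differentiableOn_integral_of_dominated ?_ ?_ ?_)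
  · intro z _
    have hm : Measurable (G z) := by
      simp only [hG]
      fun_prop
    exact hm.aestronglyMeasurable
  · exact Eventually.of_forall fun y ↦ (differentiable_integrand_param _).differentiableOn
  · intro z₀ _
    have hint : IntegrableOn (fun _ : ℝ ↦ Real.exp (-β) * (β + 1) ^ (‖z₀‖ + 1) *
        Real.exp (π * (‖z₀‖ + 1))) (Ioc (-1 : ℝ) 1) volume :=
      integrableOn_const (hs := measure_Ioc_lt_top.ne)
    refine ⟨1, one_pos, subset_univ _, fun _ ↦ Real.exp (-β) * (β + 1) ^ (‖z₀‖ + 1) *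
      Real.exp (π * (‖z₀‖ + 1)), hint, ?_⟩
    rw [ae_restrict_iff' measurableSet_Ioc]
    refine Eventually.of_forall fun y hy z hz ↦ ?_
    have hz' : ‖z‖ ≤ ‖z₀‖ + 1 := by
      have h2 : ‖z - z₀‖ < 1 := by rwa [← dist_eq_norm]
      linarith [norm_le_insert' z z₀]
    have hy1 : |y| ≤ 1 := abs_le.2 ⟨hy.1.le, hy.2⟩
    set w : ℂ := ((-β : ℝ) : ℂ) + (y : ℂ) * I with hw
    have hwre : w.re = -β := by simp [hw]
    have hw0 : w ≠ 0 := fun h ↦ by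
      have := congrArg Complex.re h; rw [hwre] at this; simp at this; linarith
    have hwn1 : 1 ≤ ‖w‖ := by
      calc (1 : ℝ) ≤ β := hβ
        _ = |w.re| := by rw [hwre, abs_neg, abs_of_pos (by linarith)]
        _ ≤ ‖w‖ := abs_re_le_norm w
    have hwB : ‖w‖ ≤ β + 1 := by
      calc ‖w‖ ≤ |(-β : ℝ)| + |y| := norm_add_mul_I_le _ _
        _ ≤ β + 1 := by rw [abs_neg, abs_of_pos (by linarith)]; linarith
    have hre : |z.re| ≤ ‖z₀‖ + 1 := (abs_re_le_norm z).trans hz'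
    have him : |z.im| ≤ ‖z₀‖ + 1 := (abs_im_le_norm z).trans hz'
    calc ‖G z y‖ = ‖exp (w - z * log w)‖ := rfl
      _ ≤ Real.exp w.re * ‖w‖ ^ (-z.re) * Real.exp (π * |z.im|) := norm_integrand_le hw0
      _ ≤ Real.exp (-β) * (β + 1) ^ |z.re| * Real.exp (π * |z.im|) := by
          rw [hwre]; gcongr; exact rpow_neg_re_le' hwn1 hwB
      _ ≤ Real.exp (-β) * (β + 1) ^ (‖z₀‖ + 1) * Real.exp (π * (‖z₀‖ + 1)) := by
          refine mul_le_mul (mul_le_mul_of_nonneg_left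
            (Real.rpow_le_rpow_of_exponent_le (by linarith) hre) (Real.exp_pos _).le)
            (Real.exp_le_exp.2 ?_) (Real.exp_pos _).le (by positivity)
          exact mul_le_mul_of_nonneg_left him Real.pi_pos.le

/-- The tail `∫_β^∞ exp(−v − z log v) dv` (`β ≥ 1`) is entire in `z` (dominated differentiation with
the majorant `e^{−v} v^{‖z₀‖+1}`). [folklore] -/
theorem differentiable_tail {β : ℝ} (hβ : 1 ≤ β) :
    Differentiable ℂ (fun z : ℂ ↦ ∫ v in Ioi β, exp (-(v : ℂ) - z * Real.log v)) := by
  set G : ℂ → ℝ → ℂ := fun z v ↦ exp (-(v : ℂ) - z * Real.log v) with hG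
  show Differentiable ℂ (fun z : ℂ ↦ ∫ v, G z v ∂(volume.restrict (Ioi β)))
  refine differentiableOn_univ.1 (differentiableOn_integral_of_dominated ?_ ?_ ?_)
  · intro z _
    have hm : Measurable (G z) := by
      simp only [hG]
      fun_prop
    exact hm.aestronglyMeasurable
  · exact Eventually.of_forall fun v ↦ by
      simp only [hG]
      fun_prop
  · intro z₀ _
    set R : ℝ := ‖z₀‖ + 1 with hR
    have hR0 : 0 < R := by positivity
    -- the majorant `e^{-v} v^{R}` is integrable on `(β, ∞)` (a Gamma integral)
    have hint : IntegrableOn (fun v : ℝ ↦ Real.exp (-v) * v ^ R) (Ioi β) volume := by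
      have h := Real.GammaIntegral_convergent (s := R + 1) (by linarith)
      have e : (fun x : ℝ ↦ Real.exp (-x) * x ^ (R + 1 - 1)) = fun x ↦ Real.exp (-x) * x ^ R := by
        funext x; rw [add_sub_cancel_right]
      rw [e] at h
      exact h.mono_set (Ioi_subset_Ioi (by linarith))
    refine ⟨1, one_pos, subset_univ _, fun v ↦ Real.exp (-v) * v ^ R, hint, ?_⟩
    rw [ae_restrict_iff' measurableSet_Ioi]
    refine Eventually.of_forall fun v hv z hz ↦ ?_
    have hv1 : 1 ≤ v := hβ.trans (le_of_lt hv)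
    have hv0 : 0 < v := by linarith
    have hz' : ‖z‖ ≤ R := by
      have h2 : ‖z - z₀‖ < 1 := by rwa [← dist_eq_norm]
      rw [hR]
      linarith [norm_le_insert' z z₀]
    have hre : -z.re ≤ R := by
      have := neg_le_abs z.re
      linarith [abs_re_le_norm z, this]
    rw [hG]
    simp only
    rw [norm_exp]
    have e1 : (-(v : ℂ) - z * Real.log v).re = -v + (-z.re) * Real.log v := by
      simp [sub_re, mul_re]; ring
    rw [e1, Real.exp_add, Real.rpow_def_of_pos hv0]
    refine mul_le_mul_of_nonneg_left ?_ (Real.exp_pos _).le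
    rw [Real.exp_le_exp]
    calc -z.re * Real.log v ≤ R * Real.log v :=
          mul_le_mul_of_nonneg_right hre (Real.log_nonneg hv1)
      _ = Real.log v * R := mul_comm _ _

/-- **Hankel's identity, truncated form, for all `z`** (analytic continuation of
`loop_sub_eq_of_re_lt_one` from `Re z < 1`: both sides are entire in `z`). [cite: MontgomeryVaughan2007, Theorem C.3] -/
theorem loop_sub_eq (z : ℂ) {β : ℝ} (hβ : 1 ≤ β) :
    rectBoundaryIntegral (fun w ↦ exp (w - z * log w)) (-β) 1 (-1) 1 +
        I * (∫ y in (-1 : ℝ)..1, exp ((((-β : ℝ) : ℂ) + (y : ℂ) * I) -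
          z * log (((-β : ℝ) : ℂ) + (y : ℂ) * I))) -
        2 * π * I / Complex.Gamma z =
      I * (∫ y in (-1 : ℝ)..1, exp ((((-β : ℝ) : ℂ) + (y : ℂ) * I) -
          z * log (((-β : ℝ) : ℂ) + (y : ℂ) * I))) -
        2 * I * Complex.sin (π * z) * ∫ v in Ioi β, exp (-(v : ℂ) - z * Real.log v) := by
  -- both sides as entire functions of `z`
  set L : ℂ → ℂ := fun z ↦ rectBoundaryIntegral (fun w ↦ exp (w - z * log w)) (-β) 1 (-1) 1 +
        I * (∫ y in (-1 : ℝ)..1, exp ((((-β : ℝ) : ℂ) + (y : ℂ) * I) -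
          z * log (((-β : ℝ) : ℂ) + (y : ℂ) * I))) -
        2 * π * I / Complex.Gamma z with hL
  set Rt : ℂ → ℂ := fun z ↦ I * (∫ y in (-1 : ℝ)..1, exp ((((-β : ℝ) : ℂ) + (y : ℂ) * I) -
          z * log (((-β : ℝ) : ℂ) + (y : ℂ) * I))) -
        2 * I * Complex.sin (π * z) * ∫ v in Ioi β, exp (-(v : ℂ) - z * Real.log v) with hRt
  have hleft := differentiable_leftEdge hβ
  have htail := differentiable_tail hβ
  have hloop := differentiable_loop β
  -- `rect + i·left = loop`
  have hrect : ∀ z : ℂ, rectBoundaryIntegral (fun w ↦ exp (w - z * log w)) (-β) 1 (-1) 1 +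
      I * (∫ y in (-1 : ℝ)..1, exp ((((-β : ℝ) : ℂ) + (y : ℂ) * I) -
          z * log (((-β : ℝ) : ℂ) + (y : ℂ) * I))) =
      (∫ x in -β..1, exp (((x : ℂ) + ((-1 : ℝ) : ℂ) * I) - z * log ((x : ℂ) + ((-1 : ℝ) : ℂ) * I))) -
      (∫ x in -β..1, exp (((x : ℂ) + ((1 : ℝ) : ℂ) * I) - z * log ((x : ℂ) + ((1 : ℝ) : ℂ) * I))) +
      I * ∫ y in (-1 : ℝ)..1, exp ((((1 : ℝ) : ℂ) + (y : ℂ) * I) -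
        z * log (((1 : ℝ) : ℂ) + (y : ℂ) * I)) := by
    intro z
    rw [rectBoundaryIntegral]
    push_cast
    ring
  have hLd : Differentiable ℂ L := by
    have e : L = fun z ↦ ((∫ x in -β..1, exp (((x : ℂ) + ((-1 : ℝ) : ℂ) * I) -
          z * log ((x : ℂ) + ((-1 : ℝ) : ℂ) * I))) -
        (∫ x in -β..1, exp (((x : ℂ) + ((1 : ℝ) : ℂ) * I) - z * log ((x : ℂ) + ((1 : ℝ) : ℂ) * I))) +
        I * ∫ y in (-1 : ℝ)..1, exp ((((1 : ℝ) : ℂ) + (y : ℂ) * I) -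
          z * log (((1 : ℝ) : ℂ) + (y : ℂ) * I))) - 2 * π * I * (Complex.Gamma z)⁻¹ := by
      funext z; rw [hL]; simp only; rw [hrect z, div_eq_mul_inv]
    rw [e]
    exact hloop.sub (Complex.differentiable_one_div_Gamma.const_mul _)
  have hRd : Differentiable ℂ Rt :=
    (hleft.const_mul I).sub (((Complex.differentiable_sin.comp (differentiable_id.const_mul _)).const_mul
      _).mul htail)
  -- they agree on the open set `Re z < 1`, a neighbourhood of `0`
  have hagree : ∀ w : ℂ, w.re < 1 → L w = Rt w := by
    intro w hw
    simp only [hL, hRt]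
    rw [loop_sub_eq_of_re_lt_one hw hβ, tail_eq_exp_form w (by linarith)]
  have hev : (fun w ↦ L w - Rt w) =ᶠ[𝓝 (0 : ℂ)] 0 := by
    have hopen : IsOpen {w : ℂ | w.re < 1} := isOpen_lt continuous_re continuous_const
    filter_upwards [hopen.mem_nhds (show (0 : ℂ) ∈ {w : ℂ | w.re < 1} by simp)] with w hw
    simp [hagree w hw]
  have hana : AnalyticOnNhd ℂ (fun w ↦ L w - Rt w) univ :=
    ((hLd.sub hRd).differentiableOn).analyticOnNhd isOpen_univ
  have hzero := hana.eqOn_zero_of_preconnected_of_eventuallyEq_zero isPreconnected_univ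
    (mem_univ 0) hev
  have := hzero (mem_univ z)
  simp only [Pi.zero_apply, sub_eq_zero] at this
  exact this


/-! ### The exponentially small pieces -/

/-- `‖sin(πz)‖ ≤ e^{π|Im z|}`. [folklore] -/
theorem norm_sin_pi_mul_le (z : ℂ) : ‖Complex.sin (π * z)‖ ≤ Real.exp (π * |z.im|) := by
  have h := two_I_mul_sin z
  have h2 : ‖2 * I * Complex.sin (π * z)‖ = 2 * ‖Complex.sin (π * z)‖ := by
    rw [norm_mul, norm_mul, Complex.norm_I, Complex.norm_two, mul_one]
  have e1 : ‖exp (π * z * I)‖ = Real.exp (-(π * z.im)) := by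
    rw [norm_exp]; congr 1; simp
  have e2 : ‖exp (-(π * z * I))‖ = Real.exp (π * z.im) := by
    rw [norm_exp]; congr 1; simp
  have hb1 : Real.exp (-(π * z.im)) ≤ Real.exp (π * |z.im|) := by
    rw [Real.exp_le_exp]; nlinarith [neg_abs_le z.im, Real.pi_pos]
  have hb2 : Real.exp (π * z.im) ≤ Real.exp (π * |z.im|) := by
    rw [Real.exp_le_exp]; nlinarith [le_abs_self z.im, Real.pi_pos]
  have : 2 * ‖Complex.sin (π * z)‖ ≤ 2 * Real.exp (π * |z.im|) := by
    rw [← h2, h]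
    calc ‖exp (π * z * I) - exp (-(π * z * I))‖ ≤ ‖exp (π * z * I)‖ + ‖exp (-(π * z * I))‖ :=
          norm_sub_le _ _
      _ ≤ Real.exp (π * |z.im|) + Real.exp (π * |z.im|) := by rw [e1, e2]; exact add_le_add hb1 hb2
      _ = 2 * Real.exp (π * |z.im|) := by ring
  linarith

/-- `uⁿ ≤ n! 2ⁿ e^{u/2}` for `u ≥ 0` (Taylor bound `(u/2)ⁿ/n! ≤ e^{u/2}`). [folklore] -/
theorem pow_le_factorial_mul_exp_half {u : ℝ} (hu : 0 ≤ u) (n : ℕ) :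
    u ^ n ≤ n.factorial * 2 ^ n * Real.exp (u / 2) := by
  have h := Real.pow_div_factorial_le_exp (u / 2) (by linarith) n
  have hf : (0 : ℝ) < n.factorial := by exact_mod_cast Nat.factorial_pos n
  rw [div_pow, div_div, div_le_iff₀ (by positivity)] at h
  calc u ^ n ≤ Real.exp (u / 2) * (2 ^ n * n.factorial) := h
    _ = n.factorial * 2 ^ n * Real.exp (u / 2) := by ring

/-- **The tail**: for `‖z‖ ≤ R ≤ n` and `β ≥ 1`,
`‖∫_β^∞ exp(−v − z log v) dv‖ ≤ n! 2^{n+1} e^{−β/2}`. [cite: MontgomeryVaughan2007, §7.4 p. 178] -/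
theorem norm_tail_le {z : ℂ} {R : ℝ} {n : ℕ} (hz : ‖z‖ ≤ R) (hRn : R ≤ n) {β : ℝ} (hβ : 1 ≤ β) :
    ‖∫ v in Ioi β, exp (-(v : ℂ) - z * Real.log v)‖ ≤
      n.factorial * 2 ^ (n + 1) * Real.exp (-β / 2) := by
  set g : ℝ → ℝ := fun v ↦ (n.factorial * 2 ^ n) * Real.exp (-(1 / 2) * v) with hg
  have hgi : IntegrableOn g (Ioi β) volume :=
    (integrableOn_exp_mul_Ioi (by norm_num : -(1 / 2 : ℝ) < 0) β).const_mul _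
  have hbound : ∀ᵐ v : ℝ ∂(volume.restrict (Ioi β)),
      ‖exp (-((v : ℝ) : ℂ) - z * Real.log v)‖ ≤ g v := by
    rw [ae_restrict_iff' measurableSet_Ioi]
    refine Eventually.of_forall fun v hv ↦ ?_
    have hv1 : 1 ≤ v := hβ.trans (le_of_lt hv)
    have hv0 : 0 < v := by linarith
    have hre : -z.re ≤ (n : ℝ) := by
      linarith [neg_le_abs z.re, abs_re_le_norm z]
    rw [norm_exp]
    have e1 : (-(v : ℂ) - z * Real.log v).re = -v + (-z.re) * Real.log v := by
      simp [sub_re, mul_re]; ring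
    rw [e1, Real.exp_add]
    have h1 : Real.exp (-z.re * Real.log v) ≤ v ^ n := by
      calc Real.exp (-z.re * Real.log v) ≤ Real.exp ((n : ℝ) * Real.log v) := by
            rw [Real.exp_le_exp]
            exact mul_le_mul_of_nonneg_right hre (Real.log_nonneg hv1)
        _ = v ^ n := by
            rw [show (n : ℝ) * Real.log v = Real.log v * n by ring, ← Real.rpow_def_of_pos hv0,
              Real.rpow_natCast]
    have h2 : v ^ n ≤ n.factorial * 2 ^ n * Real.exp (v / 2) := pow_le_factorial_mul_exp_half hv0.le n
    calc Real.exp (-v) * Real.exp (-z.re * Real.log v) ≤ Real.exp (-v) * (n.factorial * 2 ^ n *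
        Real.exp (v / 2)) := mul_le_mul_of_nonneg_left (h1.trans h2) (Real.exp_pos _).le
      _ = g v := by
          rw [hg]; simp only
          rw [show (n.factorial : ℝ) * 2 ^ n * Real.exp (-(1 / 2) * v) =
            n.factorial * 2 ^ n * (Real.exp (-v) * Real.exp (v / 2)) by
              rw [← Real.exp_add]; congr 1; ring]
          ring
  calc ‖∫ v in Ioi β, exp (-(v : ℂ) - z * Real.log v)‖ ≤ ∫ v in Ioi β, g v :=
        norm_integral_le_of_norm_le hgi hbound
    _ = (n.factorial * 2 ^ n) * (-Real.exp (-(1 / 2) * β) / (-(1 / 2))) := by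
        rw [hg, MeasureTheory.integral_const_mul, integral_exp_mul_Ioi (by norm_num : -(1 / 2 : ℝ) < 0)]
    _ = n.factorial * 2 ^ (n + 1) * Real.exp (-β / 2) := by
        rw [pow_succ]
        have : -(1 / 2 : ℝ) * β = -β / 2 := by ring
        rw [this]
        ring

/-- **The left edge**: for `‖z‖ ≤ R ≤ n` and `β ≥ 1`,
`‖∫_{−1}^{1} F(−β + iy) dy‖ ≤ 2 n! 2ⁿ e^{1/2} e^{πR} e^{−β/2}`. [cite: MontgomeryVaughan2007, §7.4 p. 178] -/
theorem norm_leftEdge_le {z : ℂ} {R : ℝ} {n : ℕ} (hz : ‖z‖ ≤ R) (hRn : R ≤ n) {β : ℝ} (hβ : 1 ≤ β) :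
    ‖∫ y in (-1 : ℝ)..1, exp ((((-β : ℝ) : ℂ) + (y : ℂ) * I) -
        z * log (((-β : ℝ) : ℂ) + (y : ℂ) * I))‖ ≤
      2 * (n.factorial * 2 ^ n * Real.exp (1 / 2) * Real.exp (π * R)) * Real.exp (-β / 2) := by
  have hR : 0 ≤ R := (norm_nonneg z).trans hz
  have hpt : ∀ y ∈ Ι (-1 : ℝ) 1, ‖exp ((((-β : ℝ) : ℂ) + (y : ℂ) * I) -
      z * log (((-β : ℝ) : ℂ) + (y : ℂ) * I))‖ ≤
      n.factorial * 2 ^ n * Real.exp (1 / 2) * Real.exp (π * R) * Real.exp (-β / 2) := by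
    intro y hy
    rw [uIoc_of_le (by norm_num)] at hy
    have hy1 : |y| ≤ 1 := abs_le.2 ⟨hy.1.le, hy.2⟩
    set w : ℂ := ((-β : ℝ) : ℂ) + (y : ℂ) * I with hw
    have hwre : w.re = -β := by simp [hw]
    have hw0 : w ≠ 0 := fun h ↦ by
      have := congrArg Complex.re h; rw [hwre] at this; simp at this; linarith
    have hwn1 : 1 ≤ ‖w‖ := by
      calc (1 : ℝ) ≤ β := hβ
        _ = |w.re| := by rw [hwre, abs_neg, abs_of_pos (by linarith)]
        _ ≤ ‖w‖ := abs_re_le_norm w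
    have hwB : ‖w‖ ≤ β + 1 := by
      calc ‖w‖ ≤ |(-β : ℝ)| + |y| := norm_add_mul_I_le _ _
        _ ≤ β + 1 := by rw [abs_neg, abs_of_pos (by linarith)]; linarith
    have hre : |z.re| ≤ (n : ℝ) := ((abs_re_le_norm z).trans hz).trans hRn
    have him : |z.im| ≤ R := (abs_im_le_norm z).trans hz
    -- `(β+1)^{|Re z|} e^{−β} ≤ (β+1)ⁿ e^{−β} ≤ n! 2ⁿ e^{(β+1)/2} e^{−β}`
    have hpow : (β + 1) ^ |z.re| ≤ n.factorial * 2 ^ n * Real.exp ((β + 1) / 2) := by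
      calc (β + 1) ^ |z.re| ≤ (β + 1) ^ (n : ℝ) :=
            Real.rpow_le_rpow_of_exponent_le (by linarith) hre
        _ = (β + 1) ^ n := Real.rpow_natCast _ _
        _ ≤ n.factorial * 2 ^ n * Real.exp ((β + 1) / 2) :=
            pow_le_factorial_mul_exp_half (by linarith) n
    calc ‖exp (w - z * log w)‖ ≤ Real.exp w.re * ‖w‖ ^ (-z.re) * Real.exp (π * |z.im|) :=
          norm_integrand_le hw0
      _ ≤ Real.exp (-β) * (n.factorial * 2 ^ n * Real.exp ((β + 1) / 2)) * Real.exp (π * R) := by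
          rw [hwre]
          refine mul_le_mul (mul_le_mul_of_nonneg_left ((rpow_neg_re_le' hwn1 hwB).trans hpow)
            (Real.exp_pos _).le) (Real.exp_le_exp.2 ?_) (Real.exp_pos _).le (by positivity)
          exact mul_le_mul_of_nonneg_left him Real.pi_pos.le
      _ = n.factorial * 2 ^ n * Real.exp (1 / 2) * Real.exp (π * R) * Real.exp (-β / 2) := by
          have : Real.exp (-β) * Real.exp ((β + 1) / 2) = Real.exp (1 / 2) * Real.exp (-β / 2) := by
            rw [← Real.exp_add, ← Real.exp_add]; congr 1; ring
          calc Real.exp (-β) * (n.factorial * 2 ^ n * Real.exp ((β + 1) / 2)) * Real.exp (π * R)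
              = n.factorial * 2 ^ n * (Real.exp (-β) * Real.exp ((β + 1) / 2)) * Real.exp (π * R) := by
                ring
            _ = _ := by rw [this]; ring
  have h := intervalIntegral.norm_integral_le_of_norm_le_const hpt
  rw [show |(1 : ℝ) - -1| = 2 by norm_num] at h
  linarith

/-! ### Hankel's formula, truncated and rectangular (the form used in MV §7.4) -/

/-- **Hankel's loop integral for `1/Γ(z)`, truncated rectangular form** (Montgomery–Vaughan,
Theorem C.3 with the truncation estimate of §7.4, p. 178): for every `R` there is `C` such that
for all `β ≥ 1` and `‖z‖ ≤ R`, with `F(w) = e^{w} w^{−z} = exp(w − z Log w)`,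
`‖∫_{−β}^{1} F(x − i) dx − ∫_{−β}^{1} F(x + i) dx + i ∫_{−1}^{1} F(1 + iy) dy − 2πi/Γ(z)‖ ≤ C e^{−β/2}`
— the integral of `e^{w} w^{−z}` over the loop `−β − i → 1 − i → 1 + i → −β + i` is `2πi/Γ(z)` up to
an error `≪_R e^{−β/2}`. [cite: MontgomeryVaughan2007, Appendix C Theorem C.3; §7.4 p. 178] -/
theorem hankel_loop_sub_inv_Gamma_le (R : ℝ) :
    ∃ C : ℝ, 0 ≤ C ∧ ∀ β : ℝ, 1 ≤ β → ∀ z : ℂ, ‖z‖ ≤ R →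
      ‖(∫ x in -β..1, exp (((x : ℂ) - I) - z * log ((x : ℂ) - I))) -
        (∫ x in -β..1, exp (((x : ℂ) + I) - z * log ((x : ℂ) + I))) +
        I * (∫ y in (-1 : ℝ)..1, exp (((1 : ℂ) + (y : ℂ) * I) - z * log ((1 : ℂ) + (y : ℂ) * I))) -
        2 * π * I / Complex.Gamma z‖ ≤ C * Real.exp (-β / 2) := by
  set n : ℕ := ⌈R⌉₊ with hn
  have hRn : R ≤ n := Nat.le_ceil R
  set K : ℝ := n.factorial * 2 ^ n with hK
  refine ⟨2 * (K * Real.exp (1 / 2) * Real.exp (π * R)) + 2 * Real.exp (π * R) * (K * 2),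
    by positivity, fun β hβ z hz ↦ ?_⟩
  have hR : 0 ≤ R := (norm_nonneg z).trans hz
  -- rewrite the clean edge parametrisations into the `rectBoundaryIntegral` convention
  have e1 : ∀ x : ℝ, (x : ℂ) - I = (x : ℂ) + ((-1 : ℝ) : ℂ) * I := fun x ↦ by push_cast; ring
  have e2 : ∀ x : ℝ, (x : ℂ) + I = (x : ℂ) + ((1 : ℝ) : ℂ) * I := fun x ↦ by push_cast; ring
  have e3 : ∀ y : ℝ, (1 : ℂ) + (y : ℂ) * I = ((1 : ℝ) : ℂ) + (y : ℂ) * I := fun y ↦ by push_cast; ring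
  simp only [e1, e2, e3]
  have key := loop_sub_eq z hβ
  have hrect : rectBoundaryIntegral (fun w ↦ exp (w - z * log w)) (-β) 1 (-1) 1 +
      I * (∫ y in (-1 : ℝ)..1, exp ((((-β : ℝ) : ℂ) + (y : ℂ) * I) -
          z * log (((-β : ℝ) : ℂ) + (y : ℂ) * I))) =
      (∫ x in -β..1, exp (((x : ℂ) + ((-1 : ℝ) : ℂ) * I) - z * log ((x : ℂ) + ((-1 : ℝ) : ℂ) * I))) -
      (∫ x in -β..1, exp (((x : ℂ) + ((1 : ℝ) : ℂ) * I) - z * log ((x : ℂ) + ((1 : ℝ) : ℂ) * I))) +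
      I * ∫ y in (-1 : ℝ)..1, exp ((((1 : ℝ) : ℂ) + (y : ℂ) * I) -
        z * log (((1 : ℝ) : ℂ) + (y : ℂ) * I)) := by
    rw [rectBoundaryIntegral]
    push_cast
    ring
  rw [hrect] at key
  rw [key]
  have hleft := norm_leftEdge_le hz hRn hβ
  have htail := norm_tail_le hz hRn hβ
  have hsin := norm_sin_pi_mul_le z
  have him : |z.im| ≤ R := (abs_im_le_norm z).trans hz
  have hsin' : ‖Complex.sin (π * z)‖ ≤ Real.exp (π * R) :=
    hsin.trans (Real.exp_le_exp.2 (mul_le_mul_of_nonneg_left him Real.pi_pos.le))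
  calc ‖I * (∫ y in (-1 : ℝ)..1, exp ((((-β : ℝ) : ℂ) + (y : ℂ) * I) -
          z * log (((-β : ℝ) : ℂ) + (y : ℂ) * I))) -
        2 * I * Complex.sin (π * z) * ∫ v in Ioi β, exp (-(v : ℂ) - z * Real.log v)‖
      ≤ ‖I * (∫ y in (-1 : ℝ)..1, exp ((((-β : ℝ) : ℂ) + (y : ℂ) * I) -
          z * log (((-β : ℝ) : ℂ) + (y : ℂ) * I)))‖ +
        ‖2 * I * Complex.sin (π * z) * ∫ v in Ioi β, exp (-(v : ℂ) - z * Real.log v)‖ :=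
        norm_sub_le _ _
    _ = ‖∫ y in (-1 : ℝ)..1, exp ((((-β : ℝ) : ℂ) + (y : ℂ) * I) -
          z * log (((-β : ℝ) : ℂ) + (y : ℂ) * I))‖ +
        2 * ‖Complex.sin (π * z)‖ * ‖∫ v in Ioi β, exp (-(v : ℂ) - z * Real.log v)‖ := by
        rw [norm_mul, Complex.norm_I, one_mul, norm_mul, norm_mul, norm_mul, Complex.norm_I,
          Complex.norm_two, mul_one]
    _ ≤ 2 * (K * Real.exp (1 / 2) * Real.exp (π * R)) * Real.exp (-β / 2) +
        2 * Real.exp (π * R) * (K * 2 * Real.exp (-β / 2)) := by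
        have htail' : ‖∫ v in Ioi β, exp (-(v : ℂ) - z * Real.log v)‖ ≤
            K * 2 * Real.exp (-β / 2) := by
          calc ‖∫ v in Ioi β, exp (-(v : ℂ) - z * Real.log v)‖
              ≤ n.factorial * 2 ^ (n + 1) * Real.exp (-β / 2) := htail
            _ = K * 2 * Real.exp (-β / 2) := by rw [hK, pow_succ]; ring
        refine add_le_add hleft ?_
        exact mul_le_mul (mul_le_mul_of_nonneg_left hsin' (by norm_num)) htail'
          (norm_nonneg _) (by positivity)
    _ = (2 * (K * Real.exp (1 / 2) * Real.exp (π * R)) + 2 * Real.exp (π * R) * (K * 2)) *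
        Real.exp (-β / 2) := by ring

end Hankel

end Literature.Analysis.Complex
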